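import Literature.Topology.FourManifolds.FillLemma
import Literature.Topology.FourManifolds.SweepBelowLevel
import HarnessLib

/-!
# Filling a bubble of the complement hanging below a level

Topic `Literature/Topology/FourManifolds`; geometric form of the fill lemma (`FillLemma.lean`),
twin of `SweepBelowLevel.lean`, in the exp-height line of the fact seat
`provefact-Literature.Topology.FourManifolds.SphereEmbedding.schoenflies_exists_ball`
(Alexander's theorem, Schultens (2014), Thm. 3.2.5).  **Everything in this file is proved; no
definitions, no named facts.**

In Alexander's argument the innermost level disc `D` may lie *outside* the ball `B` bounded by
the sphere; then the ball between `D` and the saddle-free disc `D₁ ⊂ S` is added to `B`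
(Schultens (2014), proof of Thm. 3.2.5, PDF pp. 44–45, and Lemma 3.2.3).  On the level of the
region `A = {F ≤ 0}` this is the filling of a *bubble*: a compact, relatively open piece `V` of
`{F ≥ 0} ∩ {h ≤ a}` (`h = ⟪v, ·⟫`), with the boundary transverse to the level at the corner and
**no boundary point of `V` strictly below the level at which the outward normal of `A` is
`-v`**, is swallowed by the rising levels of the height:

* `SmoothMax.exists_diffeomorph_image_fill_below` — for `N = thickening r V` isolating `V`,
  every admissible positive part `P` and all small `δ > 0`, a diffeomorphism `Φ` of the ambient
  space supported in `thickening (2r) V` carries `A` onto `A ∪ (N ∩ {F ⊓_δ (h - a) ≤ 0})` —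
  `A` with the bubble added and the new face on the level plane, the concave junction rounded
  by the smooth minimum `u ⊓_δ v = u - δ P((u - v)/δ)` — and `∂A` onto
  `(∂A ∖ N) ∪ (N ∩ {F ⊓_δ (h - a) = 0})`.  (For a bubble *above* a level apply it to `-v, -a`.)

Proof: the fill lemma `SmoothMax.exists_diffeomorph_image_fill` with the sweep function
`w = 1 + (h - a)(1 - ψ) + M ψ` (`ψ` a smooth cutoff vanishing on `cthickening r V` and `= 1`
off `thickening (2r) V`, so that `{w ≤ 1 + ε}` is bounded) and the compact set
`K ∪ cthickening (2r) V`; its hypotheses come from the uniform regularity of `F` near `∂A`,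
the isolation of `V` (`SmoothMax.exists_thickening_inter_subset`), and the cone compactness
argument (`ExpHeight.exists_pos_forall_mem_of_cone`) applied to `-F`.

## References

* J. Schultens, *Introduction to 3-Manifolds*, GSM 151 (2014), Lemma 3.2.3 and Thm. 3.2.5
  (PDF pp. 42–45). [Schultens2014]
* J. Milnor, *Morse theory*, Ann. of Math. Studies 51 (1963), Thm. 3.1. [Milnor1963]
-/

open scoped RealInnerProductSpace Topology Manifold ContDiff
open Set Filter Metric Function

noncomputable section

namespace Literature.Topology.FourManifolds

namespace SmoothMax

variable {E : Type*} [NormedAddCommGroup E] [InnerProductSpace ℝ E] [FiniteDimensional ℝ E]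

/-- **Filling a bubble of the complement hanging below a level.**  Let `A = {F ≤ 0}` be a
compact regular domain in a finite-dimensional inner product space (`{F ≤ ε₀} ⊆ K` compact,
`DF ≠ 0` on `∂A`), `v ≠ 0` a direction with height `h = ⟪v, ·⟫`, `a` a level, and
`V ⊆ {F ≥ 0} ∩ {h ≤ a}` a compact, relatively open piece of the closure of the complement
below the level (a *bubble*: it meets the rest of `{F ≥ 0}` only along the level), such that
the boundary `∂A` is transverse to the level at the corner points of `V` and **no boundary
point of `V` strictly below the level has outward normal `-v`** (for a disc of the sphere
below a level disc lying outside the ball: no saddle and no interior minimum of the height with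
the region above it — Schultens (2014), proof of Thm. 3.2.5, case `k = 0` with `D ⊄ B`).
Then the bubble can be filled by the rising levels of the height: for `N = thickening r V`
isolating `V`, every admissible positive part `P` and all small `δ > 0`, a diffeomorphism `Φ`
of the ambient space supported in `thickening (2r) V` carries `A` onto
`A ∪ (N ∩ {F ⊓_δ (h - a) ≤ 0})` — `A` with the bubble added, the new face on the level plane,
the concave junction rounded by the smooth minimum `u ⊓_δ v = u - δ P((u - v)/δ)` — and `∂A`
onto the corresponding hypersurface.  Proof: the fill lemma
`SmoothMax.exists_diffeomorph_image_fill` with `w = 1 + (h - a)(1 - ψ) + M ψ`. [folklore] -/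
theorem exists_diffeomorph_image_fill_below {P : ℝ → ℝ} (hP : ContDiff ℝ ∞ P)
    (hP0 : ∀ s, s ≤ -1 → P s = 0) (hP1 : ∀ s, 1 ≤ s → P s = s)
    (hPd : ∀ s, 0 ≤ deriv P s ∧ deriv P s ≤ 1) (hPge : ∀ s, max 0 s ≤ P s)
    (hPle : ∀ s, P s ≤ max 0 s + 1)
    {F : E → ℝ} (hF : ContDiff ℝ ∞ F) {K : Set E} (hK : IsCompact K) {ε₀ : ℝ} (hε₀ : 0 < ε₀)
    (hKF : ∀ x, F x ≤ ε₀ → x ∈ K) (hreg : ∀ x, F x = 0 → fderiv ℝ F x ≠ 0)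
    {v : E} (hv : v ≠ 0) {a : ℝ} {V U : Set E} (hVc : IsCompact V) (hU : IsOpen U)
    (hV : {x | 0 ≤ F x ∧ ⟪v, x⟫ ≤ a} ∩ U = V)
    (hT : ∀ x ∈ V, F x = 0 → ⟪v, x⟫ = a → ∀ c : ℝ, fderiv ℝ F x ≠ c • innerSL ℝ v)
    (hS : ∀ x ∈ V, F x = 0 → ⟪v, x⟫ < a → ∀ c : ℝ, c < 0 → fderiv ℝ F x ≠ c • innerSL ℝ v) :
    ∃ r, 0 < r ∧ (∀ x, 0 ≤ F x → ⟪v, x⟫ ≤ a → x ∈ thickening (3 * r) V → x ∈ V) ∧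
      ∃ δ₀, 0 < δ₀ ∧ ∀ δ, 0 < δ → δ < δ₀ →
        ∃ Φ : E ≃ₘ⟮𝓘(ℝ, E), 𝓘(ℝ, E)⟯ E,
          Φ '' {x | F x ≤ 0} = {x | F x ≤ 0} ∪
            (thickening r V ∩ {x | F x - δ * P ((F x - (⟪v, x⟫ - a)) / δ) ≤ 0}) ∧
          Φ '' {x | F x = 0} = ({x | F x = 0} \ thickening r V) ∪
            (thickening r V ∩ {x | F x - δ * P ((F x - (⟪v, x⟫ - a)) / δ) = 0}) ∧
          (∀ x, x ∉ thickening (2 * r) V → Φ x = x) := by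
  -- notation
  set A' : Set E := {x | 0 ≤ F x} with hA'
  set Aa : Set E := {x | 0 ≤ F x ∧ ⟪v, x⟫ ≤ a} with hAa
  have hFc : Continuous F := hF.continuous
  have hhs : ContDiff ℝ ∞ fun x : E => ⟪v, x⟫ := (innerSL ℝ v).contDiff
  have hhc : Continuous fun x : E => ⟪v, x⟫ := hhs.continuous
  have hA'c : IsClosed A' := isClosed_le continuous_const hFc
  have hAac : IsClosed Aa := hA'c.inter (isClosed_le hhc continuous_const)
  have hVsub : V ⊆ Aa := by rw [← hV]; exact inter_subset_left
  -- Step 1: isolation radius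
  obtain ⟨r, hr, hiso⟩ := exists_thickening_inter_subset hAac hVc hU hV
  refine ⟨r, hr, fun x hF0 hh hx => hiso x ⟨hF0, hh⟩ hx, ?_⟩
  have hcth : IsCompact (cthickening (2 * r) V) := hVc.cthickening
  -- Step 2: the shell estimate on `A' ∩ (cthickening (2r) V \ thickening r V)`
  obtain ⟨r', hr', hshell⟩ : ∃ r', 0 < r' ∧ ∀ x ∈ A', x ∈ cthickening (2 * r) V →
      x ∉ thickening r V → a + r' ≤ ⟪v, x⟫ := by
    set S : Set E := A' ∩ (cthickening (2 * r) V \ thickening r V) with hS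
    have hSc : IsCompact S :=
      (hcth.diff isOpen_thickening).of_isClosed_subset (hA'c.inter
        (isClosed_cthickening.sdiff isOpen_thickening)) inter_subset_right
    have hpos : ∀ x ∈ S, a < ⟪v, x⟫ := by
      intro x hx
      by_contra hle
      push Not at hle
      have hxV : x ∈ V := hiso x ⟨hx.1, hle⟩
        (cthickening_subset_thickening' (by positivity) (by linarith) V hx.2.1)
      exact hx.2.2 (self_subset_thickening hr V hxV)
    by_cases hne : S.Nonempty
    · obtain ⟨x₀, hx₀, hmin⟩ := hSc.exists_isMinOn hne hhc.continuousOn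
      refine ⟨⟪v, x₀⟫ - a, by linarith [hpos x₀ hx₀], fun x hxA hx1 hx2 => ?_⟩
      have := hmin (show x ∈ S from ⟨hxA, hx1, hx2⟩)
      simp only [mem_setOf_eq] at this
      linarith
    · exact ⟨1, one_pos, fun x hxA hx1 hx2 => (hne ⟨x, hxA, hx1, hx2⟩).elim⟩
  -- Step 3: the cone estimate for `-F` (outward normal `-v`)
  set L : Set E := A' ∩ cthickening r V with hL
  have hLc : IsCompact L := (hVc.cthickening).of_isClosed_subset
    (hA'c.inter isClosed_cthickening) inter_subset_right
  have hnF : ContDiff ℝ ∞ fun x => -F x := hF.neg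
  have hDneg : ∀ x, fderiv ℝ (fun y => -F y) x = -fderiv ℝ F x := fun x => fderiv_neg
  obtain ⟨η, hη, hcone0⟩ : ∃ η, 0 < η ∧ ∀ x ∈ L, (fun y => -F y) x = 0 →
      (∃ c : ℝ, 0 ≤ c ∧ fderiv ℝ (fun y => -F y) x = c • innerSL ℝ v) → a + 2 * η < ⟪v, x⟫ := by
    set L₀ : Set E := {x ∈ L | F x = 0 ∧ ∃ c : ℝ, 0 ≤ c ∧ -fderiv ℝ F x = c • innerSL ℝ v}
      with hL₀
    have hcone_closed : IsClosed {x : E | ∃ c : ℝ, 0 ≤ c ∧ -fderiv ℝ F x = c • innerSL ℝ v} := by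
      have hDc : Continuous fun x => -fderiv ℝ F x := (hF.continuous_fderiv (by simp)).neg
      have h1 : Continuous fun x => (-fderiv ℝ F x) v :=
        (ContinuousLinearMap.apply ℝ ℝ v).continuous.comp hDc
      have : {x : E | ∃ c : ℝ, 0 ≤ c ∧ -fderiv ℝ F x = c • innerSL ℝ v} =
          {x | -fderiv ℝ F x = ((‖v‖ ^ 2)⁻¹ * (-fderiv ℝ F x) v) • innerSL ℝ v ∧
            0 ≤ (-fderiv ℝ F x) v} := by
        ext x; exact ExpHeight.exists_nonneg_eq_smul_iff hv _
      rw [this]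
      exact (isClosed_eq hDc ((continuous_const.mul h1).smul continuous_const)).inter
        (isClosed_le continuous_const h1)
    have hL₀c : IsCompact L₀ := by
      refine hLc.of_isClosed_subset ?_ (fun x hx => hx.1)
      exact (hLc.isClosed.inter ((isClosed_singleton.preimage hFc).inter hcone_closed))
    have hpos : ∀ x ∈ L₀, a < ⟪v, x⟫ := by
      rintro x ⟨hxL, hx0, hc⟩
      by_contra hle
      push Not at hle
      have hxV : x ∈ V := hiso x ⟨hxL.1, hle⟩
        (cthickening_subset_thickening' (by positivity) (by linarith) V hxL.2)
      obtain ⟨c, hc0, hc⟩ := hc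
      have hc' : fderiv ℝ F x = (-c) • innerSL ℝ v := by
        rw [neg_smul, ← hc, neg_neg]
      rcases hle.lt_or_eq with hlt | heq
      · rcases hc0.lt_or_eq with hc0' | hc0'
        · exact hS x hxV hx0 hlt (-c) (by linarith) hc'
        · exact hreg x hx0 (by rw [hc', ← hc0', neg_zero, zero_smul])
      · exact hT x hxV hx0 heq (-c) hc'
    by_cases hne : L₀.Nonempty
    · obtain ⟨x₀, hx₀, hmin⟩ := hL₀c.exists_isMinOn hne hhc.continuousOn
      refine ⟨(⟪v, x₀⟫ - a) / 3, by linarith [hpos x₀ hx₀], fun x hxL hx0 hc => ?_⟩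
      have hx0' : F x = 0 := by simpa using hx0
      rw [hDneg] at hc
      have := hmin (show x ∈ L₀ from ⟨hxL, hx0', hc⟩)
      simp only [mem_setOf_eq] at this
      linarith [hpos x₀ hx₀]
    · refine ⟨1, one_pos, fun x hxL hx0 hc => (hne ⟨x, hxL, ?_, ?_⟩).elim⟩
      · simpa using hx0
      · rw [hDneg] at hc; exact hc
  obtain ⟨ε₁, hε₁, hcone⟩ := ExpHeight.exists_pos_forall_mem_of_cone (hnF.of_le (by norm_cast))
    hv hLc (isOpen_lt continuous_const hhc) (W := {x | a + 2 * η < ⟪v, x⟫})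
    (fun x hxL hx0 hc => hcone0 x hxL hx0 hc)
  -- Step 4: uniform regularity on the collar
  obtain ⟨μ, hμ, ε₂, hε₂, hDF⟩ := ExpHeight.exists_norm_fderiv_ge (hF.of_le (by norm_cast)) hK
    (fun x _ hx => hreg x hx)
  -- Step 5: the cutoff and the sweep function
  obtain ⟨ψ, hψ0, hψ1, hψ01⟩ := exists_contMDiffMap_zero_one_of_isClosed 𝓘(ℝ, E)
    (isClosed_cthickening : IsClosed (cthickening r V))
    (isOpen_thickening.isClosed_compl : IsClosed (thickening (2 * r) V)ᶜ)
    (by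
      rw [Set.disjoint_compl_right_iff_subset]
      exact cthickening_subset_thickening' (by positivity) (by linarith) V) (n := (⊤ : ℕ∞))
  have hψs : ContDiff ℝ ∞ (ψ : E → ℝ) := ψ.contMDiff.contDiff
  -- the compact set of the fill lemma and bounds on it
  set K' : Set E := K ∪ cthickening (2 * r) V with hK'
  have hK'c : IsCompact K' := hK.union hcth
  obtain ⟨C, hC⟩ : ∃ C, ∀ x ∈ K', |⟪v, x⟫| + |F x| ≤ C := by
    obtain ⟨C, hC⟩ := hK'c.exists_bound_of_continuousOn
      ((continuous_abs.comp hhc).add (continuous_abs.comp hFc)).continuousOn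
    exact ⟨C, fun x hx => le_trans (le_abs_self _) (by simpa [Real.norm_eq_abs] using hC x hx)⟩
  set M : ℝ := 2 + |a| + |C| with hM
  have hM1 : 1 ≤ M := by have := abs_nonneg a; have := abs_nonneg C; linarith
  set w : E → ℝ := fun x => 1 + (⟪v, x⟫ - a) * (1 - ψ x) + M * ψ x with hw
  have hws : ContDiff ℝ ∞ w :=
    (contDiff_const.add ((hhs.sub contDiff_const).mul (contDiff_const.sub hψs))).add
      (contDiff_const.mul hψs)
  -- off `thickening (2r) V`: `w = 1 + M`
  have hw_far : ∀ x, x ∉ thickening (2 * r) V → w x = 1 + M := fun x hx => by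
    have h1 : ψ x = 1 := hψ1 hx
    simp only [hw, h1]; ring
  -- off `thickening r V` inside `A'`: `w ≥ 1 + min r' 1`
  set m : ℝ := min r' 1 with hm
  have hm0 : 0 < m := lt_min hr' one_pos
  have hw_off : ∀ x ∈ A', x ∉ thickening r V → 1 + m ≤ w x := by
    intro x hxA hx
    have hψx := hψ01 x
    have hmin1 := min_le_left r' 1
    have hmin2 := min_le_right r' 1
    by_cases h2 : x ∈ cthickening (2 * r) V
    · have hh := hshell x hxA h2 hx
      -- `w - 1 = (h - a)(1 - ψ) + M ψ ≥ min (h - a) M ≥ m`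
      simp only [hw]
      nlinarith [hψx.1, hψx.2]
    · rw [hw_far x fun h => h2 (thickening_subset_cthickening _ _ h)]
      linarith
  -- on `thickening r V`: `ψ = 0` near `x`, `w = 1 + (h - a)`, `Dw = ⟪v, ·⟫`
  have hψN : ∀ x ∈ thickening r V, ψ x = 0 := fun x hx =>
    hψ0 (thickening_subset_cthickening _ _ hx)
  have hwN : ∀ x ∈ thickening r V, w x = 1 + (⟪v, x⟫ - a) := fun x hx => by
    simp only [hw, hψN x hx, sub_zero, mul_one, mul_zero, add_zero]
  have hDwN : ∀ x ∈ thickening r V, fderiv ℝ w x = innerSL ℝ v := by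
    intro x hx
    have hev : w =ᶠ[𝓝 x] fun y => 1 + (⟪v, y⟫ - a) :=
      (isOpen_thickening.eventually_mem hx).mono fun y hy => hwN y hy
    rw [hev.fderiv_eq]
    have h1 : HasFDerivAt (fun y : E => 1 + (⟪v, y⟫ - a)) (innerSL ℝ v) x := by
      have := ((innerSL ℝ v).hasFDerivAt (x := x)).sub_const a |>.const_add 1
      simpa using this
    exact h1.fderiv
  have hℓ : (innerSL ℝ v : E →L[ℝ] ℝ) ≠ 0 := by
    intro h
    have : (innerSL ℝ v : E →L[ℝ] ℝ) v = 0 := by rw [h]; rfl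
    rw [innerSL_apply_apply, real_inner_self_eq_norm_sq] at this
    exact hv (norm_eq_zero.1 (pow_eq_zero_iff two_ne_zero |>.1 this))
  -- Step 6: the smallness of `δ`
  set ε₀' : ℝ := min ε₀ (1 / 2) with hε₀'
  have hε₀'pos : 0 < ε₀' := lt_min hε₀ (by norm_num)
  refine ⟨min (m / 4) (min (ε₁ / 2) (min (ε₂ / 2) (min η (ε₀' / 2)))), by positivity,
    fun δ hδ hδ₀ => ?_⟩
  have hδm : 4 * δ < m := by
    have := min_le_left (m / 4) (min (ε₁ / 2) (min (ε₂ / 2) (min η (ε₀' / 2)))); linarith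
  have hrest := (min_le_right (m / 4) (min (ε₁ / 2) (min (ε₂ / 2) (min η (ε₀' / 2)))))
  have hδ1 : 2 * δ ≤ ε₁ := by
    have := hrest.trans (min_le_left _ _); linarith
  have hδ2 : 2 * δ ≤ ε₂ := by
    have := hrest.trans ((min_le_right _ _).trans (min_le_left _ _)); linarith
  have hδη : δ ≤ η := by
    have := hrest.trans ((min_le_right _ _).trans ((min_le_right _ _).trans (min_le_left _ _)))
    linarith
  have hδε2 : 2 * δ < ε₀' := by
    have := hrest.trans ((min_le_right _ _).trans ((min_le_right _ _).trans (min_le_right _ _)))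
    linarith
  have hδε : δ < ε₀' := by linarith
  have hε₀'le : ε₀' ≤ ε₀ := min_le_left _ _
  -- Step 7: the hypotheses of the fill lemma
  have hKF' : ∀ x, F x ≤ ε₀' → x ∈ K' := fun x hx =>
    Or.inl (hKF x (hx.trans (min_le_left _ _)))
  have hKw' : ∀ x, w x ≤ 1 + ε₀' → x ∈ K' := by
    intro x hx
    refine Or.inr (thickening_subset_cthickening _ _ ?_)
    by_contra h2
    rw [hw_far x h2] at hx
    have := min_le_right ε₀ (1 / 2)
    linarith
  have hKL : ∀ x, 0 ≤ F x → w x ≤ 1 + 2 * δ → x ∈ thickening r V := by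
    intro x hx hwx
    by_contra hN
    have := hw_off x hx hN
    linarith
  have H1 : ∀ x, 0 ≤ F x → F x ≤ 2 * δ → fderiv ℝ F x ≠ 0 := by
    intro x h1 h2
    have hxK : x ∈ K := hKF x (by linarith)
    have := hDF x hxK (by rw [abs_le]; constructor <;> linarith)
    exact fun h => by rw [h, norm_zero] at this; linarith
  have H2 : ∀ x, 0 ≤ F x → w x ≤ 1 + 2 * δ → fderiv ℝ w x ≠ 0 := by
    intro x hx hwx
    rw [hDwN x (hKL x hx hwx)]
    exact hℓ
  have H3 : ∀ x, 0 ≤ F x → F x ≤ 2 * δ → w x ≤ 1 + 2 * δ → ∀ c : ℝ, c < 0 →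
      fderiv ℝ w x ≠ c • fderiv ℝ F x := by
    intro x h1 h2 hwx c hc hcw
    have hxN := hKL x h1 hwx
    rw [hDwN x hxN] at hcw
    have hcone' : ∃ c' : ℝ, 0 ≤ c' ∧ fderiv ℝ (fun y => -F y) x = c' • innerSL ℝ v := by
      refine ⟨-c⁻¹, by rw [neg_nonneg]; exact (inv_lt_zero.2 hc).le, ?_⟩
      rw [hDneg, hcw, smul_smul, neg_mul, inv_mul_cancel₀ hc.ne, neg_smul, one_smul]
    have hxL : x ∈ L := ⟨h1, thickening_subset_cthickening _ _ hxN⟩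
    have := hcone x hxL (show -ε₁ ≤ -F x by linarith) (show -F x ≤ 0 by linarith) hcone'
    simp only [mem_setOf_eq] at this
    have hwx' := hwN x hxN
    linarith
  -- Step 8: the fill lemma
  obtain ⟨Φ, himg, hzero, hfix, hKfix⟩ := exists_diffeomorph_image_fill hP hP0 hP1 hPd hPge hPle
    hF hws hK'c hKF' hKw' hδ hδε H1 H2 H3
  -- Step 9: identification of the filled region
  have hout : ∀ x, x ∉ thickening r V → 0 ≤ F x →
      (F x - δ * P ((F x - (w x - 1)) / δ) ≤ 0 ↔ F x ≤ 0) ∧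
        (F x - δ * P ((F x - (w x - 1)) / δ) = 0 ↔ F x = 0) := by
    intro x hxN hxA
    have hw1 : m ≤ w x - 1 := by linarith [hw_off x hxA hxN]
    by_cases hcase : F x ≤ (w x - 1) - δ
    · rw [smin_eq_left hP0 hδ hcase]
      exact ⟨Iff.rfl, Iff.rfl⟩
    · push Not at hcase
      have hgt : 0 < F x - δ * P ((F x - (w x - 1)) / δ) := by
        have := min_sub_le_smin hPle hδ (F x) (w x - 1)
        have hmin : 3 * δ < min (F x) (w x - 1) := lt_min (by linarith) (by linarith)
        linarith
      have hFpos : 0 < F x := by linarith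
      exact ⟨⟨fun h => absurd h (not_le.2 hgt), fun h => absurd h (not_le.2 hFpos)⟩,
        ⟨fun h => absurd h hgt.ne', fun h => absurd h hFpos.ne'⟩⟩
  have hneg_in : ∀ x, F x < 0 → F x - δ * P ((F x - (w x - 1)) / δ) < 0 := fun x hx =>
    lt_of_le_of_lt ((smin_le_min hPge hδ (F x) (w x - 1)).trans (min_le_left _ _)) hx
  have hle_in : ∀ x, F x ≤ 0 → F x - δ * P ((F x - (w x - 1)) / δ) ≤ 0 := fun x hx =>
    ((smin_le_min hPge hδ (F x) (w x - 1)).trans (min_le_left _ _)).trans hx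
  have hin : ∀ x ∈ thickening r V, F x - (w x - 1) = F x - (⟪v, x⟫ - a) := fun x hx => by
    rw [hwN x hx]; ring
  refine ⟨Φ, ?_, ?_, fun x hx => ?_⟩
  · rw [himg]
    ext x
    simp only [mem_setOf_eq, mem_union, mem_inter_iff]
    by_cases hxN : x ∈ thickening r V
    · rw [hin x hxN]
      refine ⟨fun h => Or.inr ⟨hxN, h⟩, fun h => h.elim (fun h' => ?_) fun h' => h'.2⟩
      rw [← hin x hxN]; exact hle_in x h'
    · constructor
      · intro h
        refine Or.inl ?_
        rcases le_or_gt 0 (F x) with hle | hgt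
        · exact (hout x hxN hle).1.1 h
        · exact hgt.le
      · intro h
        rcases h with h | h
        · exact hle_in x h
        · exact (hxN h.1).elim
  · rw [hzero]
    ext x
    simp only [mem_setOf_eq, mem_union, Set.mem_sdiff, mem_inter_iff]
    by_cases hxN : x ∈ thickening r V
    · rw [hin x hxN]
      exact ⟨fun h => Or.inr ⟨hxN, h⟩, fun h => h.elim (fun h' => (h'.2 hxN).elim) fun h' => h'.2⟩
    · constructor
      · intro h
        refine Or.inl ⟨?_, hxN⟩
        rcases le_or_gt 0 (F x) with hle | hgt
        · exact (hout x hxN hle).2.1 h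
        · exact absurd h (hneg_in x hgt).ne
      · intro h
        rcases h with h | h
        · exact (hout x hxN h.1.ge).2.2 h.1
        · exact (hxN h.1).elim
  · by_cases hxK : x ∈ K'
    · refine hfix x ?_
      rw [hw_far x hx]
      have hCx := hC x hxK
      have := le_abs_self (F x); have := abs_nonneg ⟪v, x⟫; have := le_abs_self C
      have := abs_nonneg a
      have : δ < 1 := by linarith [hδm, min_le_right r' 1]
      simp only [hM]; linarith
    · exact hKfix x hxK

end SmoothMax

end Literature.Topology.FourManifolds

end
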